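import Summits.BirchSwinnertonDyer.BirchSwinnertonDyer.Theses.PAdicOrderV2
import Summits.BirchSwinnertonDyer.BirchSwinnertonDyer.Theses.Squeeze
import Literature.NumberTheory.EllipticCurves.OrdinaryPrimesProofs

/-!
# BirchSwinnertonDyer / PAdicOrderV2 — crux `PAdicOrderThesisR2` (stmt-0487), line `Sketch`:
# the two open stubs among the remaining sibling items (route Squeeze; crux #3 of this route)

Complement to `Theorems/PAdicOrderV2PAdicOrderThesisR2StubWiring.lean` (which places
`stub_UB_pos` below crux #2 `PAdicOrderComparisonR2` / crux #5 `PAdicOrderRankOneR4` and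
`stub_LB_ge2` below `HigherGZConstructionR2`, and shows both lower-bound stubs NECESSARY for `X`).
Here the remaining item-level sources of the open stubs of line `Sketch` are recorded, sorry-free:

* `analyticRank_le_mordellWeilRank_of_squeeze` — the full lower bound of BSD, `r_an ≤ r_MW` for
  every elliptic `W/ℚ`, from the two Squeeze cruxes `SqueezeLBplusOne` (stmt-BirchSwinnertonDyer-0144:
  `r_an ≤ r_MW + 1`) and `SqueezeParity` (stmt-BirchSwinnertonDyer-0146: `r_MW ≡ r_an (mod 2)`):
  the value `r_MW + 1` has the wrong parity. Hence `stub_LB_ge2_of_squeeze` and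
  `stub_LB_rank1_of_squeeze` — the registered lower-bound stubs of the skeleton follow from
  Squeeze #3 ∧ #5 (an alternative to `HigherGZConstructionR2`, stmt-0501, and to the named fact
  `rank_eq_analyticRank_of_analyticRank_le_one` in rank one).
* `stub_UB_pos_of_padicBSDrank_of_UB` — the one-prime upper bound `stub_UB_pos` from crux #3
  `PAdicOrderPadicBSDrankR2` (stmt-BirchSwinnertonDyer-0490: `ord_T L_p = r_MW` at every good
  ordinary prime) together with the UPPER bound of BSD `SqueezeUBR2` (stmt-BirchSwinnertonDyer-0496:
  `r_MW ≤ r_an`), at the prime of `exists_good_ordinary_prime_holds` (Serre 1981, §8): an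
  alternative to crux #2 (`stub_UB_pos_of_comparison`).
* `padicOrderThesisR2_of_padicBSDrank_of_bsd` — and `X` itself from modularity (inlined exactly as
  in `CruxesToThesis`), crux #3 and BSD-rank for globally minimal models (`r_an = r_MW`), without
  crux #2: at any good ordinary `p ≥ 5`, `ord = r_MW = r_an`.

So the item-level cover of the open residue of the line reads: UB ∈ {#2 (0489), #5 (0515, rank 1),
#3 ∧ SqueezeUBR2 (0490 ∧ 0496)}, LB ∈ {HigherGZConstructionR2 (0501), SqueezeLBplusOne ∧
SqueezeParity (0144 ∧ 0146), GZK (rank 1)}. Nothing here is asserted unconditionally about `X`.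
-/

-- single-conjunct summit: `Summit.BirchSwinnertonDyer.BirchSwinnertonDyer.…` repeats the name by design
set_option linter.dupNamespace false

namespace Summit.BirchSwinnertonDyer.BirchSwinnertonDyer.Cruxes.PAdicOrderThesisR2.KatoSandwich

open Literature.NumberTheory.EllipticCurves Literature.NumberTheory.EllipticCurves.ModularForms
open Summit.BirchSwinnertonDyer.BirchSwinnertonDyer.Theses

/-- **BSD lower bound from Squeeze #3 ∧ #5.** If `SqueezeLBplusOne` (stmt-0144: `r_an ≤ r_MW + 1`
for every elliptic `W/ℚ`) and `SqueezeParity` (stmt-0146: `r_MW` even iff `r_an` even) hold, then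
`r_an(W) ≤ r_MW(W)` for every elliptic `W/ℚ`: `r_an = r_MW + 1` would violate parity. [folklore] -/
theorem analyticRank_le_mordellWeilRank_of_squeeze (hLB1 : Squeeze.SqueezeLBplusOne)
    (hpar : Squeeze.SqueezeParity) (W : WeierstrassCurve ℚ) [W.IsElliptic] :
    W.analyticRank ≤ W.mordellWeilRank := by
  have h1 : W.analyticRank ≤ W.mordellWeilRank + 1 := hLB1 W
  have h2 : Even W.mordellWeilRank ↔ Even W.analyticRank := hpar W
  rcases Nat.lt_or_ge W.analyticRank (W.mordellWeilRank + 1) with h | h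
  · omega
  · have heq : W.analyticRank = W.mordellWeilRank + 1 := le_antisymm h1 h
    rw [heq, Nat.even_add_one] at h2
    exact absurd h2.symm not_iff_self

/-- **`stub_LB_ge2` from Squeeze #3 ∧ #5** (registered signature of the skeleton stub as the
conclusion): `2 ≤ r_an ⇒ r_an ≤ r_MW` for globally minimal models, by
`analyticRank_le_mordellWeilRank_of_squeeze` (neither `2 ≤ r_an` nor minimality is used). [folklore] -/
theorem stub_LB_ge2_of_squeeze :
    Squeeze.SqueezeLBplusOne → Squeeze.SqueezeParity →
    ∀ (W : WeierstrassCurve ℚ) [W.IsElliptic] [W.IsGloballyMinimal],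
      2 ≤ W.analyticRank → W.analyticRank ≤ W.mordellWeilRank :=
  fun hLB1 hpar W _ _ _ ↦ analyticRank_le_mordellWeilRank_of_squeeze hLB1 hpar W

/-- **`stub_LB_rank1` from Squeeze #3 ∧ #5** (registered signature of the skeleton stub as the
conclusion): `r_an = 1 ⇒ 1 ≤ r_MW` for globally minimal models. [folklore] -/
theorem stub_LB_rank1_of_squeeze :
    Squeeze.SqueezeLBplusOne → Squeeze.SqueezeParity →
    ∀ (W : WeierstrassCurve ℚ) [W.IsElliptic] [W.IsGloballyMinimal],
      W.analyticRank = 1 → 1 ≤ W.mordellWeilRank := by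
  intro hLB1 hpar W _ _ h1
  rw [← h1]
  exact analyticRank_le_mordellWeilRank_of_squeeze hLB1 hpar W

/-- **`stub_UB_pos` from crux #3 and the upper bound of BSD.** If `PAdicOrderPadicBSDrankR2`
(stmt-0490: `ord_{T=0} L_p(f, α_p, T) = r_MW(E)` at every good ordinary `p`, every newform `f`) and
`SqueezeUBR2` (stmt-0496: `r_MW ≤ r_an` for every elliptic `W/ℚ`) hold, then every `E/ℚ` (globally
minimal `W`) of positive analytic rank has a good ordinary prime `p ≥ 5`
(`exists_good_ordinary_prime_holds`, Serre 1981 §8) with `ord_{T=0} L_p(f, α_p, T) ≤ r_an(E)` for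
every newform `f` — the registered signature of `stub_UB_pos`. [cite: Serre1981, §8] -/
theorem stub_UB_pos_of_padicBSDrank_of_UB :
    PAdicOrderV2.PAdicOrderPadicBSDrankR2 → Squeeze.SqueezeUBR2 →
    ∀ (W : WeierstrassCurve ℚ) [W.IsElliptic] [W.IsGloballyMinimal], 0 < W.analyticRank →
      ∃ (p : ℕ) (_ : Fact p.Prime), 5 ≤ p ∧ IsOrdinaryAt W p ∧
        ∀ {N : ℕ} [NeZero N] (f : CuspForm (CongruenceSubgroup.Gamma0 N) 2), IsNewformOf W f →
          (padicLFunction f (unitRoot W p : ℚ_[p])).order ≤ (W.analyticRank : ℕ∞) := by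
  intro h3 hUB W _ _ _
  obtain ⟨p, hp, h5, hgood, hord⟩ := WeierstrassCurve.exists_good_ordinary_prime_holds W
  refine ⟨p, hp, h5, ⟨hgood, hord⟩, fun f hf ↦ ?_⟩
  rw [h3 W p ⟨hgood, hord⟩ f hf]
  exact_mod_cast hUB W

/-- **`X` from modularity, crux #3 and BSD-rank (no crux #2).** The crux `PAdicOrderThesisR2`
follows from modularity (inlined as in the route glue `CruxesToThesis`: every elliptic `W` with
`NeZero N_W` has a newform of level `N_W`; Breuil–Conrad–Diamond–Taylor 2001, Thm A), crux #3
`PAdicOrderPadicBSDrankR2` (stmt-0490) and BSD-rank for globally minimal models: at any good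
ordinary `p ≥ 5` (`exists_good_ordinary_prime_holds`), `ord = r_MW = r_an`. (Compare
`CruxesToThesis`: `X ⟸` modularity ∧ #2 ∧ #3; here #2 is traded for BSD-rank, which `X` implies —
`analyticRank_eq_mordellWeilRank_of_thesis` in the wiring file.)
[cite: MazurTateTeitelbaum1986Invent, §II.10] -/
theorem padicOrderThesisR2_of_padicBSDrank_of_bsd
    (hmod : ∀ (W : WeierstrassCurve ℚ) [W.IsElliptic] [NeZero (W.conductorNorm ℤ)],
      ∃ f : CuspForm (CongruenceSubgroup.Gamma0 (W.conductorNorm ℤ)) 2, IsNewformOf W f)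
    (h3 : PAdicOrderV2.PAdicOrderPadicBSDrankR2)
    (hBSD : ∀ (W : WeierstrassCurve ℚ) [W.IsElliptic] [W.IsGloballyMinimal],
      W.analyticRank = W.mordellWeilRank) :
    PAdicOrderV2.PAdicOrderThesisR2 := by
  intro W _ _
  haveI hN : NeZero (W.conductorNorm ℤ) := ⟨(W.conductorNorm_pos_holds).ne'⟩
  obtain ⟨f, hf⟩ := hmod W
  obtain ⟨p, hp, -, hgood, hord⟩ := WeierstrassCurve.exists_good_ordinary_prime_holds W
  have hO : IsOrdinaryAt W p := ⟨hgood, hord⟩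
  refine ⟨p, hp, hO, W.conductorNorm ℤ, hN, f, hf, ?_, h3 W p hO f hf⟩
  rw [h3 W p hO f hf, hBSD W]

end Summit.BirchSwinnertonDyer.BirchSwinnertonDyer.Cruxes.PAdicOrderThesisR2.KatoSandwich
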